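import Literature.RingTheory.TightClosure.TightClosure
import Mathlib.RingTheory.Ideal.Height
import Mathlib.RingTheory.Ideal.KrullsHeightTheorem
import Mathlib.RingTheory.Ideal.MinimalPrime.Noetherian
import Mathlib.RingTheory.Localization.AtPrime.Basic
import Mathlib.RingTheory.Localization.Ideal
import Mathlib.Algebra.CharP.Algebra
import HarnessLib

/-!
# F-rationality localizes: the core step (Hochster–Huneke 1994, Thm. 4.2 (f)), ring level

Support file for crux stmt-ResolutionOfSingularities-15317 (`FrobeniusLadder.FRationalResolution`),
line `Sketch`, continuation seat c3, cycle 6 (theme LOC: the crux's F-rational hypothesis is a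
closed-point condition). Setting: `R` a Noetherian domain of characteristic `p`, `P` a prime,
`x₁, …, x_h ∈ R` such that `P` is a minimal prime of `I = (x)` and all minimal primes of `I` have
the same height `h`. Two statements about the local ring `R_P`:

* `radical_span_map_atPrime_isMaximal` — the image of `(x)` in `R_P` has maximal radical (so, as
  `dim R_P = ht P = h`, the images `x₁/1, …, x_h/1` form a system of parameters of `R_P`);
* `tightlyClosed_span_map_atPrime_of_data` — **if `I` is tightly closed in `R`, elements avoiding
  the minimal primes of `I` are non-zero-divisors modulo the Frobenius powers `(x₁^q, …, x_h^q)`,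
  and there is a uniform multiplier `t ∉ P` pushing the other minimal primes of `I` into `I`, then
  `I R_P` is tightly closed in `R_P`** (inline form). Proof (HH94 4.2 (f), made explicit): if
  `c · y^q ∈ (I R_P)^[q]` for all `q = p^e` with `y = u/s₀`, `c = c'/s₁`, then
  `s_q c' u^q ∈ I^[q]` for some `s_q ∉ P`; with `t` the multiplier, the colon ideal
  `(I^[q] : t^q c' u^q)` contains `s_q ∉ P` and `a_Q^q ∉ Q` for every other minimal prime `Q`,
  hence (prime avoidance) an element avoiding all minimal primes of `I`, which is a
  non-zero-divisor modulo `I^[q]`: so `c' (t u)^q ∈ I^[q]` for all `q`, `t u ∈ I` by tight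
  closedness, and `y = (t u)/(t s₀) ∈ I R_P`.

The three hypotheses are discharged in the tree for `R = S/Q` (`S` regular local, `Q` prime) with
the crux's F-rational clause: `…PrimeAdaptedParameters.lean`, `…SopExtension.lean` +
`…PartialSopTightlyClosed.lean` (tight closedness), the unmixedness step, and
`…MultiplierOffMinimalPrime.lean`. [cite: HochsterHuneke1994, Thm. 4.2 (f)]
-/

-- single-problem summit: the doubled namespace component is forced
set_option linter.dupNamespace false

noncomputable section

namespace Summit.ResolutionOfSingularities.ResolutionOfSingularities.Theorems.FRationalResolution

open IsLocalRing Literature.RingTheory.TightClosure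

/-- The image in `R_P` of the ideal generated by a family `x` is generated by the images. -/
theorem span_range_algebraMap_eq_map {R A : Type*} [CommRing R] [CommRing A] [Algebra R A]
    {h : ℕ} (x : Fin h → R) :
    Ideal.span (Set.range fun i => algebraMap R A (x i)) =
      (Ideal.span (Set.range x)).map (algebraMap R A) := by
  rw [Ideal.map_span, ← Set.range_comp]
  rfl

/-- **Parameters adapted to `P` become a system of parameters in `R_P` (radical part).** If `P` is
a minimal prime of `I = (x₁, …, x_h)` and every minimal prime of `I` has height `h`, then the only
prime of `R_P` containing `I R_P` is the maximal ideal: `rad (I R_P) = P R_P`. -/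
theorem radical_span_map_atPrime_isMaximal (R : Type) [CommRing R] [IsNoetherianRing R]
    (P : Ideal R) [P.IsPrime] {h : ℕ} (x : Fin h → R)
    (hPmin : P ∈ (Ideal.span (Set.range x)).minimalPrimes)
    (hQh : ∀ Q ∈ (Ideal.span (Set.range x)).minimalPrimes, Q.height = h)
    (A : Type) [CommRing A] [Algebra R A] [IsLocalization.AtPrime A P] :
    (Ideal.span (Set.range fun i => algebraMap R A (x i))).radical.IsMaximal := by
  haveI : IsLocalRing A := IsLocalization.AtPrime.isLocalRing A P
  set I : Ideal R := Ideal.span (Set.range x) with hI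
  rw [span_range_algebraMap_eq_map]
  suffices hrad : (I.map (algebraMap R A)).radical = maximalIdeal A by
    rw [hrad]
    exact maximalIdeal.isMaximal A
  apply le_antisymm
  · have h1 : I.map (algebraMap R A) ≤ maximalIdeal A := by
      rw [← IsLocalization.AtPrime.map_eq_maximalIdeal P A]
      exact Ideal.map_mono hPmin.1.2
    exact (maximalIdeal.isMaximal A).isPrime.radical_le_iff.mpr h1
  · rw [Ideal.radical_eq_sInf]
    refine le_sInf fun 𝔓 h𝔓 => ?_
    obtain ⟨hI𝔓, h𝔓p⟩ := h𝔓
    haveI := h𝔓p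
    -- `Q' = 𝔓 ∩ R` is a prime with `I ≤ Q' ≤ P`
    have hIQ' : I ≤ 𝔓.under R := Ideal.map_le_iff_le_comap.mp hI𝔓
    have hQ'P : 𝔓.under R ≤ P := by
      have h2 : 𝔓 ≤ maximalIdeal A := le_maximalIdeal h𝔓p.ne_top
      have h3 : 𝔓.under R ≤ (maximalIdeal A).under R := Ideal.comap_mono h2
      rwa [IsLocalization.AtPrime.under_maximalIdeal A P] at h3
    -- a minimal prime `Q'' ≤ Q'` of `I`; it has the height of `P` and lies in `P`, so equals `P`
    obtain ⟨Q'', hQ''min, hQ''le⟩ := Ideal.exists_minimalPrimes_le hIQ'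
    haveI := hQ''min.1.1
    have hQ''P : Q'' = P := by
      refine Ideal.eq_of_le_of_height_le Q'' (hQ''le.trans hQ'P) ?_
      rw [hQh P hPmin, hQh Q'' hQ''min]
    have hQ'eq : 𝔓.under R = P := le_antisymm hQ'P (hQ''P ▸ hQ''le)
    have h𝔓eq : 𝔓 = maximalIdeal A := by
      rw [← IsLocalization.map_under P.primeCompl A 𝔓, hQ'eq,
        IsLocalization.AtPrime.map_eq_maximalIdeal P A]
    rw [h𝔓eq]

/-- **F-rationality localizes — the core (HH94 Thm. 4.2 (f)).** `R` a Noetherian domain of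
characteristic `p`, `P` a prime, `I = (x₁, …, x_h)` (in the application `P` is a minimal prime
of `I`). Assume: (`htcI`) `I` is tightly
closed in `R`; (`hcancel`) every element outside all minimal primes of `I` is a non-zero-divisor
modulo each Frobenius power `(x₁^q, …, x_h^q)`, `q = p^e`; (`hmult`) some `t ∉ P` satisfies
`a_Q t ∈ I` with `a_Q ∉ Q` for every other minimal prime `Q` of `I`. Then `I R_P` is tightly
closed in `R_P` (inline form: `c ≠ 0 ∧ (∀ e, c·y^(p^e) ∈ (I R_P)^[p^e]) ⇒ y ∈ I R_P`).
[cite: HochsterHuneke1994, Thm. 4.2 (f)] -/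
theorem tightlyClosed_span_map_atPrime_of_data (p : ℕ) [Fact p.Prime] (R : Type) [CommRing R]
    [IsDomain R] [IsNoetherianRing R] [CharP R p] (P : Ideal R) [P.IsPrime] {h : ℕ}
    (x : Fin h → R)
    (htcI : ∀ y c : R, c ≠ 0 → (∀ e : ℕ, c * y ^ p ^ e ∈
      Ideal.span ((fun z : R => z ^ p ^ e) '' (Ideal.span (Set.range x) : Set R))) →
      y ∈ Ideal.span (Set.range x))
    (hcancel : ∀ v : R, (∀ Q' ∈ (Ideal.span (Set.range x)).minimalPrimes, v ∉ Q') →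
      ∀ (e : ℕ) (w : R), v * w ∈ Ideal.span (Set.range fun i => x i ^ p ^ e) →
        w ∈ Ideal.span (Set.range fun i => x i ^ p ^ e))
    (hmult : ∃ t : R, t ∉ P ∧ ∀ Q ∈ (Ideal.span (Set.range x)).minimalPrimes, Q ≠ P →
      ∃ a : R, a ∉ Q ∧ a * t ∈ Ideal.span (Set.range x))
    (A : Type) [CommRing A] [Algebra R A] [IsLocalization.AtPrime A P] :
    ∀ y c : A, c ≠ 0 → (∀ e : ℕ, c * y ^ p ^ e ∈
      Ideal.span ((fun z : A => z ^ p ^ e) ''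
        (Ideal.span (Set.range fun i => algebraMap R A (x i)) : Set A))) →
      y ∈ Ideal.span (Set.range fun i => algebraMap R A (x i)) := by
  classical
  have hp : p.Prime := Fact.out
  set f := algebraMap R A with hf
  set I : Ideal R := Ideal.span (Set.range x) with hI
  -- `A` is a domain of characteristic `p`, `f` is injective
  have hinj : Function.Injective f :=
    IsLocalization.injective A P.primeCompl_le_nonZeroDivisors
  haveI : CharP A p := charP_of_injective_algebraMap hinj p
  -- Frobenius powers of `I` and of `I A`
  have hIq : ∀ e : ℕ, Ideal.span ((fun z : R => z ^ p ^ e) '' (I : Set R)) =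
      Ideal.span (Set.range fun i => x i ^ p ^ e) := by
    intro e
    rw [← frobeniusPower_def, hI, frobeniusPower_span p e, ← Set.range_comp]
    rfl
  have hJq : ∀ e : ℕ, Ideal.span ((fun z : A => z ^ p ^ e) '' (I.map f : Set A)) =
      (Ideal.span (Set.range fun i => x i ^ p ^ e)).map f := by
    intro e
    rw [← frobeniusPower_def, frobeniusPower_eq_map_iterateFrobenius p e, Ideal.map_map,
      ← hIq e, ← frobeniusPower_def, frobeniusPower_eq_map_iterateFrobenius p e, Ideal.map_map]
    congr 1
    ext a
    simp only [RingHom.coe_comp, Function.comp_apply, iterateFrobenius_def, map_pow]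
  intro y c hc hmem
  rw [span_range_algebraMap_eq_map] at hmem ⊢
  -- numerators: `y · f s₀ = f u`, `c · f s₁ = f c'`
  obtain ⟨⟨u, s0⟩, hys⟩ := IsLocalization.surj P.primeCompl y
  obtain ⟨⟨c', s1⟩, hcs⟩ := IsLocalization.surj P.primeCompl c
  simp only at hys hcs
  have hc' : c' ≠ 0 := by
    rintro rfl
    rw [map_zero] at hcs
    exact hc ((IsLocalization.map_units A s1).mul_left_eq_zero.mp hcs)
  -- for each `e`: `s_e · c' u^q ∈ (x^q)` for some `s_e ∉ P`
  have hse : ∀ e : ℕ, ∃ s ∈ P.primeCompl,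
      s * (c' * u ^ p ^ e) ∈ Ideal.span (Set.range fun i => x i ^ p ^ e) := by
    intro e
    have h2 : f (c' * u ^ p ^ e) = c * y ^ p ^ e * (f s1 * f s0 ^ p ^ e) := by
      rw [map_mul, map_pow, ← hcs, ← hys]
      ring
    have h1 : f (c' * u ^ p ^ e) ∈ (Ideal.span (Set.range fun i => x i ^ p ^ e)).map f := by
      rw [← hJq e, h2]
      exact Ideal.mul_mem_right _ _ (hmem e)
    exact (IsLocalization.algebraMap_mem_map_algebraMap_iff P.primeCompl A _ _).mp h1
  -- the uniform multiplier
  obtain ⟨t, htP, hta⟩ := hmult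
  have hfin : (I.minimalPrimes).Finite := Ideal.finite_minimalPrimes_of_isNoetherianRing R I
  have key : ∀ e : ℕ, c' * (t * u) ^ p ^ e ∈ Ideal.span (Set.range fun i => x i ^ p ^ e) := by
    intro e
    obtain ⟨s, hsP, hs⟩ := hse e
    set Iq : Ideal R := Ideal.span (Set.range fun i => x i ^ p ^ e) with hIqdef
    set w : R := t ^ p ^ e * (c' * u ^ p ^ e) with hw
    have hw' : c' * (t * u) ^ p ^ e = w := by rw [hw]; ring
    rw [hw']
    -- the colon ideal `K = (Iq : w)`
    set K : Ideal R := Iq.colon ({w} : Set R) with hK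
    have hKmem : ∀ v : R, v ∈ K ↔ v * w ∈ Iq := fun v => by
      rw [hK, Submodule.mem_colon_singleton, smul_eq_mul]
    have hsK : s ∈ K := by
      rw [hKmem]
      have : s * w = t ^ p ^ e * (s * (c' * u ^ p ^ e)) := by rw [hw]; ring
      rw [this]
      exact Ideal.mul_mem_left _ _ hs
    have haK : ∀ Q ∈ I.minimalPrimes, Q ≠ P → ∃ a ∉ Q, a ∈ K := by
      intro Q hQ hQP
      obtain ⟨a, haQ, hat⟩ := hta Q hQ hQP
      refine ⟨a ^ p ^ e, fun h' => haQ (hQ.1.1.mem_of_pow_mem _ h'), ?_⟩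
      rw [hKmem]
      have h3 : a ^ p ^ e * w = (a * t) ^ p ^ e * (c' * u ^ p ^ e) := by rw [hw]; ring
      rw [h3]
      refine Ideal.mul_mem_right _ _ ?_
      have h4 := pow_mem_frobeniusPower (q := p ^ e) hat
      rw [hI, frobeniusPower_span p e, ← Set.range_comp] at h4
      exact h4
    -- `K` is not inside the union of the minimal primes of `I` (prime avoidance)
    have hnot : ¬ ((K : Set R) ⊆ ⋃ Q' ∈ (↑hfin.toFinset : Set (Ideal R)), (Q' : Set R)) := by
      intro hsub
      obtain ⟨Q', hQ'mem, hKQ'⟩ := (Ideal.subset_union_prime P P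
        (fun Q hQ _ _ => (hfin.mem_toFinset.mp hQ).1.1)).mp hsub
      have hQ'min : Q' ∈ I.minimalPrimes := hfin.mem_toFinset.mp hQ'mem
      by_cases hQ'P : Q' = P
      · exact hsP (hQ'P ▸ hKQ' hsK)
      · obtain ⟨a, haQ', haK'⟩ := haK Q' hQ'min hQ'P
        exact haQ' (hKQ' haK')
    obtain ⟨v, hvK, hvU⟩ := Set.not_subset.mp hnot
    have hvQ : ∀ Q' ∈ I.minimalPrimes, v ∉ Q' := fun Q' hQ' hvQ' =>
      hvU (Set.mem_biUnion (hfin.mem_toFinset.mpr hQ') hvQ')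
    exact hcancel v hvQ e w ((hKmem v).mp hvK)
  -- tight closedness of `I` in `R`: `t u ∈ I`
  have htu : t * u ∈ I := htcI (t * u) c' hc' (fun e => by rw [hIq e]; exact key e)
  -- `y = f u / f s₀` and `f t` is a unit
  have h4 : f t * f u ∈ I.map f := by
    rw [← map_mul]
    exact Ideal.mem_map_of_mem f htu
  have htunit : IsUnit (f t) := IsLocalization.map_units A ⟨t, show t ∈ P.primeCompl from htP⟩
  have hfu : f u ∈ I.map f := by
    have h5 := Ideal.mul_mem_left _ (↑htunit.unit⁻¹ : A) h4
    rwa [← mul_assoc, IsUnit.val_inv_mul, one_mul] at h5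
  have hs0unit : IsUnit (f s0) := IsLocalization.map_units A s0
  have hy : y = f u * ↑hs0unit.unit⁻¹ := by
    rw [← hys, mul_assoc, IsUnit.mul_val_inv, mul_one]
  rw [hy]
  exact Ideal.mul_mem_right _ _ hfu

end Summit.ResolutionOfSingularities.ResolutionOfSingularities.Theorems.FRationalResolution

end
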